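import Literature.RingTheory.Idempotents.FiniteAlgebraLocalDecomposition
import Literature.RingTheory.Idempotents.SplitRelationIdempotentLifting
import HarnessLib

/-!
# A module-finite algebra over the valuation ring of an algebraically closed field is a finite product of LOCAL rings
# ([StacksProject] Tag 04GG (10.153.3 (5)) for this henselian base, proved WITHOUT Hensel's lemma)

Topic `Literature/RingTheory/Valuation`; THEOREMS ONLY (no definition, no instance, no named fact, no `sorry`).  Cell `hodgecm-mathlib`
(D-0151), FLOOR-0 P5a, (S-γ) row γ1b = the GLUE of the two γ1 halves (LEAD WORD #12 map of record): the pure-algebra SOCKETS of ★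
`Literature.RingTheory.Idempotents.FiniteAlgebraLocalDecomposition` («idempotents lift along `A → A ⧸ 𝔪A` ⇒ `A ≅ ∏_I A ⧸ (1 − e_I)` over the maximal
ideals `I` of `A ⧸ 𝔪A`, each factor LOCAL», `exists_completeOrthogonalIdempotents_isLocalRing_of_lift` ∕ `bijective_pi_of_lift`) fed with the Hensel-free
LIFTING of ★ `Literature.RingTheory.Idempotents.SplitRelationIdempotentLifting` (`ValuationSubring.exists_isIdempotentElem_mk_eq`: over a valuation subring `V`
of an ALGEBRAICALLY CLOSED field every element of an integral `V`-algebra has a split monic relation, so idempotents lift).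

RESULTS, for `V : ValuationSubring Ω`, `Ω` algebraically closed (e.g. `𝒪_{\bar K_v} ⊂ \bar K_v`, the base of the D1 reduction maps), and a commutative
`V`-algebra `A` with `[Module.Finite V A]`:
* `ValuationSubring.forall_isIdempotentElem_exists_lift` — the `hlift` socket: every idempotent of `A ⧸ 𝔪_V A` lifts;
* `ValuationSubring.exists_completeOrthogonalIdempotents_isLocalRing` — a complete orthogonal family `(e_I)` of idempotents of `A` indexed by
  the maximal ideals `I` of `A ⧸ 𝔪_V A`, with `1 − e_I ∈ I`, `e_I ∈ I′` (`I ≠ I′`), and every `A ⧸ (1 − e_I)` LOCAL;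
* `ValuationSubring.exists_bijective_pi_isLocalRing` — **`A ≅ ∏_I A ⧸ (1 − e_I)`, a finite product of local rings**.
This is the input of (γ2) «reduction of the geometric generic fibre of a finite flat cover = special-fibre 0-cycle with multiplicities» (owner F0P5a-p02):
the local factors are the blocks over the points of the special fibre.  HC_CM is proved only modulo the 7 printed citations until rung 0 closes.

## References
* [StacksProject] Tag 04GG (10.153.3 (5): over a henselian local ring finite algebras are products of local rings), Tag 09XI (15.11.6), Tag 00IC.
-/

set_option autoImplicit false

namespace Literature.RingTheory.Valuation

open IsLocalRing Literature.RingTheory.Idempotents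

variable {Ω : Type*} [Field Ω] [IsAlgClosed Ω] (V : ValuationSubring Ω)
variable {A : Type*} [CommRing A] [Algebra V A] [Module.Finite V A]

/-- **The lifting socket holds over the valuation ring of an algebraically closed field**: every idempotent of `A ⧸ 𝔪_V A` lifts to an idempotent of
the module-finite `V`-algebra `A` (★ `ValuationSubring.exists_isIdempotentElem_mk_eq`: split monic relations, no Hensel lemma).
[cite: StacksProject, Tag 04GG] [cite: StacksProject, Tag 09XI] -/
theorem _root_.ValuationSubring.forall_isIdempotentElem_exists_lift
    (eb : A ⧸ (maximalIdeal V).map (algebraMap V A)) (heb : IsIdempotentElem eb) :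
    ∃ e : A, IsIdempotentElem e ∧ Ideal.Quotient.mk _ e = eb := by
  obtain ⟨a, rfl⟩ := Ideal.Quotient.mk_surjective eb
  exact V.exists_isIdempotentElem_mk_eq _ le_rfl a heb

/-- **Blocks of a finite algebra over the valuation ring of an algebraically closed field**: there is a complete orthogonal family `(e_I)` of
idempotents of `A`, indexed by the (finitely many) maximal ideals `I` of the special fibre `A ⧸ 𝔪_V A`, with `1 − e_I ∈ I`, `e_I ∈ I′` for `I′ ≠ I`, and
every block `A ⧸ (1 − e_I)` a LOCAL ring (★ `exists_completeOrthogonalIdempotents_isLocalRing_of_lift` + the socket above).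
[cite: StacksProject, Tag 04GG] -/
theorem _root_.ValuationSubring.exists_completeOrthogonalIdempotents_isLocalRing
    [Fintype (MaximalSpectrum (A ⧸ (maximalIdeal V).map (algebraMap V A)))] :
    ∃ e : MaximalSpectrum (A ⧸ (maximalIdeal V).map (algebraMap V A)) → A, CompleteOrthogonalIdempotents e ∧
      (∀ I, 1 - e I ∈ I.asIdeal.comap (Ideal.Quotient.mk _)) ∧ (∀ I I', I ≠ I' → e I ∈ I'.asIdeal.comap (Ideal.Quotient.mk _)) ∧
      ∀ I, IsLocalRing (A ⧸ Ideal.span {1 - e I}) :=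
  exists_completeOrthogonalIdempotents_isLocalRing_of_lift (R := V) (A := A) V.forall_isIdempotentElem_exists_lift

/-- **A module-finite algebra over the valuation ring of an algebraically closed field is a finite product of local rings**:
`A ≅ ∏_{I ∈ MaxSpec(A ⧸ 𝔪_V A)} A ⧸ (1 − e_I)` (the product map of the quotient maps is bijective) with every factor local — [StacksProject 04GG (5)]
for the henselian base `V`, obtained Hensel-free. [cite: StacksProject, Tag 04GG] -/
theorem _root_.ValuationSubring.exists_bijective_pi_isLocalRing
    [Fintype (MaximalSpectrum (A ⧸ (maximalIdeal V).map (algebraMap V A)))] :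
    ∃ e : MaximalSpectrum (A ⧸ (maximalIdeal V).map (algebraMap V A)) → A, CompleteOrthogonalIdempotents e ∧
      (∀ I, IsLocalRing (A ⧸ Ideal.span {1 - e I})) ∧
      Function.Bijective (RingHom.pi fun I => Ideal.Quotient.mk (Ideal.span {1 - e I})) :=
  bijective_pi_of_lift (R := V) (A := A) V.forall_isIdempotentElem_exists_lift

/-- The index set is finite without any extra hypothesis: `A ⧸ 𝔪_V A` is artinian (★ `isArtinianRing_quotient`), so the `Fintype` binder above is
discharged by `Fintype.ofFinite`; this is the binder-free form of `ValuationSubring.exists_bijective_pi_isLocalRing`. [cite: StacksProject, Tag 04GG] -/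
theorem _root_.ValuationSubring.exists_bijective_pi_isLocalRing' :
    ∃ (_ : Fintype (MaximalSpectrum (A ⧸ (maximalIdeal V).map (algebraMap V A))))
      (e : MaximalSpectrum (A ⧸ (maximalIdeal V).map (algebraMap V A)) → A), CompleteOrthogonalIdempotents e ∧
      (∀ I, IsLocalRing (A ⧸ Ideal.span {1 - e I})) ∧
      Function.Bijective (RingHom.pi fun I => Ideal.Quotient.mk (Ideal.span {1 - e I})) := by
  haveI := isArtinianRing_quotient (R := V) (A := A)
  letI : Fintype (MaximalSpectrum (A ⧸ (maximalIdeal V).map (algebraMap V A))) := Fintype.ofFinite _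
  exact ⟨inferInstance, V.exists_bijective_pi_isLocalRing⟩

end Literature.RingTheory.Valuation
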